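import Summits.QuantumFields.YangMills.Theorems.UnitScaleTiltProp7BlockPoincareKerTopMean
import Summits.QuantumFields.YangMills.Theorems.UnitScaleTiltProp7NestedMeanTowerClosenessRefMean
import Summits.QuantumFields.YangMills.Theorems.UnitScaleTiltProp7CmapTwSReadSet
import Summits.QuantumFields.YangMills.Theorems.UnitScaleTiltProp7CovariantBlockBumpsRows
import HarnessLib

/-!
# Route `UnitScaleTilt`, crux K1 «MinimiserStabilityRegPr» (stmt-QuantumFields-19200), EX positivity block, LOD ∕ Combes–Thomas line (★p1 g24 `LOCATE-P349-CT`, ★★OWNER RULINGS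
# №33 ∕ №34) — **PEN (BUMP), FILE 3∕3: ★★★ COVARIANT BLOCK BUMPS — AN EXACT, K-UNIFORMLY `H¹`-BOUNDED RIGHT INVERSE OF THE TOP NESTED COVARIANT MEAN OF RECORD.**  For ANY
# `ℂ`-linear `Q″` with clause (iv) of ✓`Prop7NSIntertwinerOfRecord.exists_intertwiner_of_regPr` (the `Q″` of ✓`Prop7BlockPoincareKerTopMean`, brick (L1)), at `RegPr F n K ε₀ U₀`,
# `10⁷L³ε₀ ≤ 1`, `n < K`: `∃ E` linear with **`Q″(toL2S(E c)) = c`**, `‖toL2S(E c)‖² ≤ 8(27∕4)⁶·c₀(L³)^{K−n}Σ_y‖c(y)‖²`, `‖D^η_{U₀}(toL2S(E c))‖² ≤ 600(27∕4)⁶·c₀(L³)^{K−n}Σ_y‖c(y)‖²`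
# — constants free of `K − n` and of the volume

Cell `ym3-torus` (HUMAN RULING D-0037: YM₃ on T³ is ladder rung R3 — NOT d = 4, NOT infinite volume, NOT a mass gap, NOT Clay).  Width seat `ym3-torus-px10` (gen 9); chair ★p1 g24
2026-08-29T21:49:33Z «px10 g9 ← (BUMP): smooth transport-dressed block bumps `β_y` at `RegPr U₀` with `Q″β_y = e_y` exact, K-UNIFORM `‖β_y‖, ‖DL2 U₀ β_y‖`»; LOCATE
`HOME/ym3-torus-px10/g9/LOCATE-BUMP-px10g9.md` (19200 evidence #51).  THEOREMS ONLY (0 `def`, 0 `sorry`); `--supports stmt-QuantumFields-19200 --as helper`, count-neutral.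
HONEST LABEL (№33 (6)): interpolant ∕ restoration LETTERS of the curved γ-row supplier line (LOD localisation) — consumers: the GAP (L2′) `‖λ‖² ≤ 4‖D_{U₀}λ‖² + 2(√2‖D∘E‖ + ‖E‖)²|Q″λ|²`
from (L1) (split `λ = (λ − EQ″λ) + EQ″λ`) and the coarse Gram lower bound (L4′) `‖G_aQ″†c‖ ≥ |c|∕(‖Q″‖(‖D∘E‖² + a))` (energy identity, test vector `Ec`); the `H²` row `covLapSite∘E` is
NOT here (LOCATE-BUMP (W2): it needs a C¹-regular gauge or an `H²`-regularised bump); the line has ONE [B9] Thm 3.1-class Agmon brick (L3′) inside (Track A road cited); NOTHING of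
(3.49), Thm 3.3, `h349`, `hGF`, EX or the crux is proved; the constants are not optimised.

THE MATHEMATICS.  (§1) The normalised parabola profile of FILE 1 has block mass `(L^d)^{K−n}` on every block, so FILE 2's reference-mean identity and `ℓ¹`-mass row apply; ROW-T
(✓`Prop7NestedMeanTowerCloseness.norm_nsTop_sub_refMean_le_of_regPr`: the nested covariant mean is the corner-axial reference mean up to `4500L²ε₀` × the block `ℓ¹`-mass) then gives
the EXACTNESS DEFECT `‖Q″(toL2S(E_ref c))(y) − c(y)‖ ≤ 4500L²ε₀‖c(y)‖`, `4500L²ε₀ ≤ ½`.  (§2) FILE 1's pointwise Neumann lemma inverts `𝔐 : c ↦ Q″(toL2S(E_ref c))` with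
`‖(𝔐⁻¹c)(y)‖ ≤ 2‖c(y)‖`; `E := E_ref ∘ 𝔐⁻¹` is exact, and FILE 2's summation rows with `A = (27∕4)³`, `η⁻¹B = 12A(ℓ−1)ηε₀ + 4A ≤ 5A` (`(ℓ−1)η ≤ 1`, `ε₀ ≤ 1∕12`) give the two norms.
(§5) (L4′) in the abstract (chair word 22:01:23Z (2)): for ANY right inverse `E` of `Q` with `‖D∘E‖ ≤ d_E` and the weak solution `u` of `(D†D + aQ†Q)u = Q†c`,
`‖c‖ ≤ q(d_E² + a)‖u‖` — Cauchy–Schwarz in the energy with the test vectors `Ec` and `u`; no `H²` row of `E`.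

References: T. Bałaban, CMP **99** (1985) 389–434 [Balaban1985BackgroundPropagators] ((3.19) p.393, (3.114)–(3.115) p.418); CMP **98** (1985) 17–51 [Balaban1985Averaging]
((97) p.32, pp.24–25); CMP **99** (1985) 75–102 [Balaban1985RegularSpaces] (Lemma 1 (1.25) p.79); CMP **102** (1985) 277–309 [Balaban1985Variational] ((2) p.278);
CMP **95** (1984) 17–40 [Balaban1984PropagatorsI] ((1.18) p.20).
-/

set_option autoImplicit false

noncomputable section

open scoped BigOperators Matrix.Norms.L2Operator

namespace Summit.QuantumFields.YangMills.Theorems.Prop7CovariantBlockBumps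

open Literature.MathematicalPhysics.QuantumFieldTheory.Balaban1983to89
open Finset T4Continuum BlockAveraging
open B5Eq118OneStroke (iterBlockOf iterBlock mem_iterBlock val_iterBlockOf card_iterBlock)
open B15DeterminingSets (embIter)
open B7Prop1Explicit (U1 mem_U1 treeWord disp)
open B7Eq78Linearization (conjR conjR_apply conjR_sub conjR_smul)
open B8Ineq132 (norm_conjR norm_conjR_le conjR_conjR)
open B10Eq27TorusAxialLog (holT axialT transl unitsField toUField gaugeActT gaugeActT_apply)
open B7TransferAnalyticMean (meanCLM)
open B11Eq103H1Complex (SiteL2K)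
open T3ContinuumYM3Torus
open T3RegularMinimiser (regThreshold regThreshold_pos)
open T3PrintedRegularMinimiser (RegPr)
open T3SectALandauChart (eta eta_pos bgUnits)
open Summit.QuantumFields.YangMills.Theorems.Prop8Chart (emlIterU)
open Summit.QuantumFields.YangMills.Theorems.Prop7SectET3Transport (periodsT3 bgOfCfg bondEquiv isUnitaryBg_bgOfCfg val_bgOfCfg)
open Summit.QuantumFields.YangMills.Theorems.Prop7SectET3HilbertLetters (W₂ toL2S toL2 DL2 DL2_apply)
open Summit.QuantumFields.YangMills.Theorems.Prop7NestedMeanTowerCloseness (norm_nsTop_sub_refMean_le_of_regPr ref_T3_mem_U1 norm_axialGauge_bond_sub_one_le_T3)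
open Summit.QuantumFields.YangMills.Theorems.Prop7NestedMeanPoincare (normSq_toL2S_eq normSq_toL2_eq normSq_toL2S_le_two_mul conjR_unitsField_toUField)
open Summit.QuantumFields.YangMills.Theorems.Prop7CovariantCoercivity (sum_norm_sq_le_mul_opNorm_sq)
open Summit.QuantumFields.YangMills.Theorems.Prop7CovariantBlockBumpsProfile
open Summit.QuantumFields.YangMills.Theorems.Prop7CovariantBlockBumpsRows

variable (F : T3Family) {n K : ℕ}

/-! ## §3 The normalisation of the parabola profile and the exactness defect against the top nested covariant mean of record -/

section Defect

/-- **THE NORMALISED PARABOLA PROFILE HAS BLOCK MASS `(L^d)^{K−n}`** (✓`sum_iterBlock_profile_eq`; `(L^{K−n})^d = (L^d)^{K−n}`). [cite: Balaban1984PropagatorsI, (1.18) p.20] -/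
theorem sum_iterBlock_normProfile_eq (hnK : n < K) (y : Site (F.P K) (K - n)) :
    ∑ x ∈ iterBlock (K - n) y,
        ((((F.P K).L ^ (K - n) : ℕ) : ℝ)) ^ (F.P K).d /
          (((((F.P K).L ^ (K - n) : ℕ) : ℝ)) * ((((F.P K).L ^ (K - n) : ℕ) : ℝ) - 1) * ((((F.P K).L ^ (K - n) : ℕ) : ℝ) - 2) / 6) ^ (F.P K).d *
          ∏ ν : Fin (F.P K).d, (((x ν).val % (F.P K).L ^ (K - n) : ℕ) : ℝ) * ((((F.P K).L ^ (K - n) : ℕ) : ℝ) - 1 - (((x ν).val % (F.P K).L ^ (K - n) : ℕ) : ℝ))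
      = (((F.P K).L : ℝ) ^ (F.P K).d) ^ (K - n) := by
  have hℓ3 : 3 ≤ (F.P K).L ^ (K - n) := three_le_blockSide (F := F) hnK
  have hm := mass_ge hℓ3
  have hm0 : (0:ℝ) < ((((F.P K).L ^ (K - n) : ℕ) : ℝ)) ^ 3 / 27 := by positivity
  have hmass : (0:ℝ) < (((((F.P K).L ^ (K - n) : ℕ) : ℝ)) * ((((F.P K).L ^ (K - n) : ℕ) : ℝ) - 1) * ((((F.P K).L ^ (K - n) : ℕ) : ℝ) - 2) / 6) ^ (F.P K).d :=
    pow_pos (hm0.trans_le hm) _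
  rw [← mul_sum, sum_iterBlock_profile_eq (Prop7CmapTwSReadSet.height_le F n K) y, div_mul_cancel₀ _ hmass.ne']
  push_cast
  rw [← pow_mul, ← pow_mul, mul_comm]

/-- the normalised parabola profile is non-negative. [folklore] -/
theorem normProfile_nonneg (hnK : n < K) (x : Site (F.P K) 0) :
    0 ≤ ((((F.P K).L ^ (K - n) : ℕ) : ℝ)) ^ (F.P K).d /
          (((((F.P K).L ^ (K - n) : ℕ) : ℝ)) * ((((F.P K).L ^ (K - n) : ℕ) : ℝ) - 1) * ((((F.P K).L ^ (K - n) : ℕ) : ℝ) - 2) / 6) ^ (F.P K).d *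
          ∏ ν : Fin (F.P K).d, (((x ν).val % (F.P K).L ^ (K - n) : ℕ) : ℝ) * ((((F.P K).L ^ (K - n) : ℕ) : ℝ) - 1 - (((x ν).val % (F.P K).L ^ (K - n) : ℕ) : ℝ)) := by
  have hℓ3 : 3 ≤ (F.P K).L ^ (K - n) := three_le_blockSide (F := F) hnK
  have hℓ : 0 < (F.P K).L ^ (K - n) := by omega
  have hm := mass_ge hℓ3
  have hm0 : (0:ℝ) < ((((F.P K).L ^ (K - n) : ℕ) : ℝ)) ^ 3 / 27 := by positivity
  exact mul_nonneg (div_nonneg (by positivity) (pow_nonneg (hm0.le.trans hm) _)) (profile_nonneg hℓ x)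

/-- ★★ **THE EXACTNESS DEFECT OF THE DRESSED BUMP AGAINST THE TOP NESTED COVARIANT MEAN OF RECORD** (ROW-T, ✓`norm_nsTop_sub_refMean_le_of_regPr`): for ANY `ℂ`-linear `Q''` with
clause (iv) of ✓`exists_intertwiner_of_regPr` («an averaging sequence of `λ` exists, with top `Q''(toL2S λ)`»), at `RegPr F n K ε₀ U₀`, `10⁷L³ε₀ ≤ 1`, `n < K`:
`‖Q''(toL2S (E_ref c)) (y) − c(y)‖ ≤ 4500L²ε₀·‖c(y)‖` — the corner-axial reference mean of `E_ref c` IS `c` (✓`refMean_dressed_eq`), its block `ℓ¹`-mass is `(L^d)^{K−n}‖c(y)‖`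
(✓`sum_norm_dressed_eq`), and the nested mean is the reference mean up to `4500L²ε₀` × that mass. [cite: Balaban1985BackgroundPropagators, (3.19) p.393; Balaban1985Averaging, (97) p.32; Balaban1985Variational, (2) p.278] -/
theorem norm_topMean_dressed_sub_le (hnK : n < K) {ε₀ : ℝ} (hε₀ : 0 < ε₀) (hε7 : 10 ^ 7 * (F.L : ℝ) ^ 3 * ε₀ ≤ 1)
    (U₀ : GaugeField (F.P K) 0 (Matrix.specialUnitaryGroup (Fin 2) ℂ)) (hreg : RegPr F n K ε₀ U₀) {c₀ : ℝ} [Fact (0 < c₀)]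
    (Q'' : SiteL2K ℂ 3 (periodsT3 F K) c₀ W₂ →ₗ[ℂ] (Site (F.P K) (K - n) → Matrix (Fin 2) (Fin 2) ℂ))
    (hseq : ∀ lam : Site (F.P K) 0 → Matrix (Fin 2) (Fin 2) ℂ, ∃ ns : (j : ℕ) → Site (F.P K) j → Matrix (Fin 2) (Fin 2) ℂ, ns 0 = lam ∧
        (∀ (j : ℕ) (y : Site (F.P K) (j + 1)), ns (j + 1) y = ns j (emb y) - meanCLM (Idx (F.P K)) (Matrix (Fin 2) (Fin 2) ℂ) fun i : Idx (F.P K) =>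
          ns j (emb y) - ((holT (emlIterU j (bgUnits F K U₀)) (emb y) (stairWord i.2.1 (off i.1)) : (Matrix (Fin 2) (Fin 2) ℂ)ˣ) : Matrix (Fin 2) (Fin 2) ℂ) *
            ns j (transl (emb y) (disp (stairWord i.2.1 (off i.1)))) * (((holT (emlIterU j (bgUnits F K U₀)) (emb y) (stairWord i.2.1 (off i.1)))⁻¹ : (Matrix (Fin 2) (Fin 2) ℂ)ˣ) : Matrix (Fin 2) (Fin 2) ℂ)) ∧
        ns (K - n) = Q'' (toL2S F K c₀ lam))
    (c : Site (F.P K) (K - n) → Matrix (Fin 2) (Fin 2) ℂ) (y : Site (F.P K) (K - n)) :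
    ‖Q'' (toL2S F K c₀ fun x =>
          ((((((F.P K).L ^ (K - n) : ℕ) : ℝ)) ^ (F.P K).d /
            (((((F.P K).L ^ (K - n) : ℕ) : ℝ)) * ((((F.P K).L ^ (K - n) : ℕ) : ℝ) - 1) * ((((F.P K).L ^ (K - n) : ℕ) : ℝ) - 2) / 6) ^ (F.P K).d *
            ∏ ν : Fin (F.P K).d, (((x ν).val % (F.P K).L ^ (K - n) : ℕ) : ℝ) * ((((F.P K).L ^ (K - n) : ℕ) : ℝ) - 1 - (((x ν).val % (F.P K).L ^ (K - n) : ℕ) : ℝ)) : ℝ) : ℂ) •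
          conjR ((axialT (bgUnits F K U₀) (Site.fibreSite 0 (K - n) (iterBlockOf (K - n) x) fun _ => (⟨0, pow_pos (F.P K).L_pos (K - n)⟩ : Fin ((F.P K).L ^ (K - n))))
                (embIter (K - n) (iterBlockOf (K - n) x)))⁻¹ *
              axialT (bgUnits F K U₀) (Site.fibreSite 0 (K - n) (iterBlockOf (K - n) x) fun _ => (⟨0, pow_pos (F.P K).L_pos (K - n)⟩ : Fin ((F.P K).L ^ (K - n)))) x)⁻¹
              (c (iterBlockOf (K - n) x))) y
        - c y‖ ≤ 4500 * (F.L : ℝ) ^ 2 * ε₀ * ‖c y‖ := by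
  set lam : Site (F.P K) 0 → Matrix (Fin 2) (Fin 2) ℂ := fun x =>
    ((((((F.P K).L ^ (K - n) : ℕ) : ℝ)) ^ (F.P K).d /
      (((((F.P K).L ^ (K - n) : ℕ) : ℝ)) * ((((F.P K).L ^ (K - n) : ℕ) : ℝ) - 1) * ((((F.P K).L ^ (K - n) : ℕ) : ℝ) - 2) / 6) ^ (F.P K).d *
      ∏ ν : Fin (F.P K).d, (((x ν).val % (F.P K).L ^ (K - n) : ℕ) : ℝ) * ((((F.P K).L ^ (K - n) : ℕ) : ℝ) - 1 - (((x ν).val % (F.P K).L ^ (K - n) : ℕ) : ℝ)) : ℝ) : ℂ) •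
    conjR ((axialT (bgUnits F K U₀) (Site.fibreSite 0 (K - n) (iterBlockOf (K - n) x) fun _ => (⟨0, pow_pos (F.P K).L_pos (K - n)⟩ : Fin ((F.P K).L ^ (K - n))))
          (embIter (K - n) (iterBlockOf (K - n) x)))⁻¹ *
        axialT (bgUnits F K U₀) (Site.fibreSite 0 (K - n) (iterBlockOf (K - n) x) fun _ => (⟨0, pow_pos (F.P K).L_pos (K - n)⟩ : Fin ((F.P K).L ^ (K - n)))) x)⁻¹
        (c (iterBlockOf (K - n) x)) with hlam
  obtain ⟨ns, h0, hsucc, htop⟩ := hseq lam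
  have H := norm_nsTop_sub_refMean_le_of_regPr F hε₀ hε7 U₀ hreg ns lam h0 hsucc y
  have hL0 : (0 : ℝ) < (((F.P K).L : ℝ) ^ (F.P K).d) ^ (K - n) := by have := (F.P K).L_pos; positivity
  have href := refMean_dressed_eq F U₀ _ (sum_iterBlock_normProfile_eq F hnK) c y
  have hmass := sum_norm_dressed_eq F U₀ _ (normProfile_nonneg F hnK) (sum_iterBlock_normProfile_eq F hnK) c y
  rw [htop] at H
  simp only [hlam] at H href hmass ⊢
  rw [href, hmass, ← mul_assoc (((((F.P K).L : ℝ) ^ (F.P K).d) ^ (K - n))⁻¹), inv_mul_cancel₀ hL0.ne', one_mul] at H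
  exact H

end Defect

/-! ## §4 ★★★ The exact right inverse: covariant block bumps with `Q″E = 1` and K-uniform `L²`∕`H¹` rows -/

section Exact

/-- the dressed parabola bump `c ↦ E_ref c` IS `ℂ`-linear (conjugation and scalar profile). [cite: Balaban1985Averaging, (97) p.32] -/
theorem exists_linear_dressed (U₀ : GaugeField (F.P K) 0 (Matrix.specialUnitaryGroup (Fin 2) ℂ)) :
    ∃ Eref : (Site (F.P K) (K - n) → Matrix (Fin 2) (Fin 2) ℂ) →ₗ[ℂ] (Site (F.P K) 0 → Matrix (Fin 2) (Fin 2) ℂ), ∀ c x, Eref c x =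
      ((((((F.P K).L ^ (K - n) : ℕ) : ℝ)) ^ (F.P K).d /
        (((((F.P K).L ^ (K - n) : ℕ) : ℝ)) * ((((F.P K).L ^ (K - n) : ℕ) : ℝ) - 1) * ((((F.P K).L ^ (K - n) : ℕ) : ℝ) - 2) / 6) ^ (F.P K).d *
        ∏ ν : Fin (F.P K).d, (((x ν).val % (F.P K).L ^ (K - n) : ℕ) : ℝ) * ((((F.P K).L ^ (K - n) : ℕ) : ℝ) - 1 - (((x ν).val % (F.P K).L ^ (K - n) : ℕ) : ℝ)) : ℝ) : ℂ) •
      conjR ((axialT (bgUnits F K U₀) (Site.fibreSite 0 (K - n) (iterBlockOf (K - n) x) fun _ => (⟨0, pow_pos (F.P K).L_pos (K - n)⟩ : Fin ((F.P K).L ^ (K - n))))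
            (embIter (K - n) (iterBlockOf (K - n) x)))⁻¹ *
          axialT (bgUnits F K U₀) (Site.fibreSite 0 (K - n) (iterBlockOf (K - n) x) fun _ => (⟨0, pow_pos (F.P K).L_pos (K - n)⟩ : Fin ((F.P K).L ^ (K - n)))) x)⁻¹
          (c (iterBlockOf (K - n) x)) := by
  refine ⟨{ toFun := fun c x =>
              ((((((F.P K).L ^ (K - n) : ℕ) : ℝ)) ^ (F.P K).d /
                (((((F.P K).L ^ (K - n) : ℕ) : ℝ)) * ((((F.P K).L ^ (K - n) : ℕ) : ℝ) - 1) * ((((F.P K).L ^ (K - n) : ℕ) : ℝ) - 2) / 6) ^ (F.P K).d *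
                ∏ ν : Fin (F.P K).d, (((x ν).val % (F.P K).L ^ (K - n) : ℕ) : ℝ) * ((((F.P K).L ^ (K - n) : ℕ) : ℝ) - 1 - (((x ν).val % (F.P K).L ^ (K - n) : ℕ) : ℝ)) : ℝ) : ℂ) •
              conjR ((axialT (bgUnits F K U₀) (Site.fibreSite 0 (K - n) (iterBlockOf (K - n) x) fun _ => (⟨0, pow_pos (F.P K).L_pos (K - n)⟩ : Fin ((F.P K).L ^ (K - n))))
                    (embIter (K - n) (iterBlockOf (K - n) x)))⁻¹ *
                  axialT (bgUnits F K U₀) (Site.fibreSite 0 (K - n) (iterBlockOf (K - n) x) fun _ => (⟨0, pow_pos (F.P K).L_pos (K - n)⟩ : Fin ((F.P K).L ^ (K - n)))) x)⁻¹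
                  (c (iterBlockOf (K - n) x))
            map_add' := fun c c' => ?_
            map_smul' := fun a c => ?_ }, fun c x => rfl⟩
  · funext x
    simp only [Pi.add_apply, B7Eq78Linearization.conjR_add, smul_add]
  · funext x
    simp only [Pi.smul_apply, conjR_smul, RingHom.id_apply, smul_comm a]

/-- the per-bond constant of FILE 2 against `η⁻²` is K-uniform: `η⁻²·B² ≤ 25·(27∕4)⁶` (`η⁻¹B = 12A(ℓ−1)ηε₀ + 4A`, `A = (27∕4)³`, `(ℓ−1)η ≤ 1`, `ε₀ ≤ 1∕12`).
[cite: Balaban1985Variational, (2) p.278; Balaban1985UV3, (1)-(3) p.256] -/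
theorem eta_inv_sq_mul_bondConst_sq_le {ε₀ : ℝ} (hε₀ : 0 < ε₀) (hε7 : 10 ^ 7 * (F.L : ℝ) ^ 3 * ε₀ ≤ 1) :
    (eta F n K)⁻¹ ^ 2 * ((2 * (27 / 4 : ℝ) ^ (F.P K).d * (2 * ((3 : ℝ) * ((F.L : ℝ) ^ (K - n) - 1)) * regThreshold F n K ε₀)
        + (27 / 4 : ℝ) ^ (F.P K).d * (4 / ((((F.P K).L ^ (K - n) : ℕ) : ℝ)))) ^ 2) ≤ 25 * (27 / 4 : ℝ) ^ 6 := by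
  have hd3 : (F.P K).d = 3 := T3Family.P_d F K
  have hLL : ((F.P K).L : ℝ) = F.L := rfl
  have hL3 : (3 : ℝ) ≤ F.L := by
    have : 3 ≤ F.L := by obtain ⟨a, ha⟩ := F.hL.1; have := F.hL.2; omega
    exact_mod_cast this
  have hη : 0 < eta F n K := eta_pos F n K
  rw [hd3]
  have hℓr : ((((F.P K).L ^ (K - n) : ℕ) : ℝ)) = (F.L : ℝ) ^ (K - n) := by push_cast; rw [hLL]
  have hℓη : (F.L : ℝ) ^ (K - n) * eta F n K = 1 := by
    unfold eta; rw [← mul_pow, mul_inv_cancel₀ (by linarith : (F.L : ℝ) ≠ 0), one_pow]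
  have hreg : regThreshold F n K ε₀ = ε₀ * (eta F n K) ^ 2 := by
    unfold regThreshold eta; rw [← pow_mul, mul_comm 2 (K - n), pow_mul]
  have hε : ε₀ ≤ 1 / 12 := by
    have : (1:ℝ) ≤ (F.L : ℝ) ^ 3 := one_le_pow₀ (by linarith)
    nlinarith
  set A : ℝ := (27 / 4 : ℝ) ^ 3 with hA
  have hA0 : 0 < A := by positivity
  have hℓ1 : 0 ≤ (F.L : ℝ) ^ (K - n) - 1 := by
    have : (1:ℝ) ≤ (F.L : ℝ) ^ (K - n) := one_le_pow₀ (by linarith); linarith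
  have key : (eta F n K)⁻¹ * ((2 * A * (2 * ((3 : ℝ) * ((F.L : ℝ) ^ (K - n) - 1)) * regThreshold F n K ε₀)
          + A * (4 / ((((F.P K).L ^ (K - n) : ℕ) : ℝ))))) = 12 * A * (((F.L : ℝ) ^ (K - n) - 1) * eta F n K) * ε₀ + 4 * A := by
    rw [hreg, hℓr]
    field_simp
    nlinarith [hℓη]
  have hle1 : ((F.L : ℝ) ^ (K - n) - 1) * eta F n K ≤ 1 := by nlinarith [hη]
  have hbound : (eta F n K)⁻¹ * ((2 * A * (2 * ((3 : ℝ) * ((F.L : ℝ) ^ (K - n) - 1)) * regThreshold F n K ε₀)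
          + A * (4 / ((((F.P K).L ^ (K - n) : ℕ) : ℝ))))) ≤ 5 * A := by
    rw [key]
    have ht : ((F.L : ℝ) ^ (K - n) - 1) * eta F n K * ε₀ ≤ 1 / 12 :=
      (mul_le_mul hle1 hε hε₀.le zero_le_one).trans (by norm_num)
    nlinarith [ht, hA0]
  have hnn : 0 ≤ (eta F n K)⁻¹ * ((2 * A * (2 * ((3 : ℝ) * ((F.L : ℝ) ^ (K - n) - 1)) * regThreshold F n K ε₀)
          + A * (4 / ((((F.P K).L ^ (K - n) : ℕ) : ℝ))))) := by
    rw [key]; have := mul_nonneg hℓ1 hη.le; positivity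
  calc (eta F n K)⁻¹ ^ 2 * ((2 * A * (2 * ((3 : ℝ) * ((F.L : ℝ) ^ (K - n) - 1)) * regThreshold F n K ε₀)
          + A * (4 / ((((F.P K).L ^ (K - n) : ℕ) : ℝ)))) ^ 2)
      = ((eta F n K)⁻¹ * ((2 * A * (2 * ((3 : ℝ) * ((F.L : ℝ) ^ (K - n) - 1)) * regThreshold F n K ε₀)
          + A * (4 / ((((F.P K).L ^ (K - n) : ℕ) : ℝ)))))) ^ 2 := by ring
    _ ≤ (5 * A) ^ 2 := pow_le_pow_left₀ hnn hbound 2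
    _ = 25 * (27 / 4 : ℝ) ^ 6 := by rw [hA]; ring

/-- ★★★ **COVARIANT BLOCK BUMPS — AN EXACT, K-UNIFORMLY `H¹`-BOUNDED RIGHT INVERSE OF THE TOP NESTED COVARIANT MEAN OF RECORD.**  At a printed-regular background
`U₀ ∈ 𝔘_k(ε₀)` (`RegPr F n K ε₀ U₀`, `10⁷L³ε₀ ≤ 1`, `n < K`), for ANY `ℂ`-linear `Q''` with clause (iv) of ✓`Prop7NSIntertwinerOfRecord.exists_intertwiner_of_regPr` (every gauge
parameter has an averaging sequence — the `meanCLM` recursion with the stair transports of the background tower — whose top is `Q''(toL2S λ)`), there is a `ℂ`-linear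
`E : (T^{(K−n)} → M₂) → (T_η → M₂)` with
(i) **`Q''(toL2S (E c)) = c`** for every coarse field `c` (EXACT right inverse);
(ii) `‖toL2S (E c)‖² ≤ 8·(27∕4)⁶ · c₀(L³)^{K−n} · Σ_y ‖c(y)‖²`;
(iii) `‖D^η_{U₀}(toL2S (E c))‖² ≤ 600·(27∕4)⁶ · c₀(L³)^{K−n} · Σ_y ‖c(y)‖²`
— constants free of `K − n` and of the volume (`c₀(L³)^{K−n}` = the fine weight times the sites per block, the natural coarse weight; operator norms on `M₂`).  CONSTRUCTION: the
corner-axial dressed parabola bump `E_ref` of FILE 2 (reference mean `c` EXACTLY; nested mean `c` up to `κ = 4500L²ε₀ ≤ ½`, §3), composed with the inverse of `c ↦ Q''(toL2S(E_ref c))`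
from the pointwise Neumann lemma of FILE 1 (`‖·(y)‖ ≤ 2‖c(y)‖`).  USE (LOD line, ★★OWNER RULING №34): the GAP (L2′) from (L1) ✓`Prop7BlockPoincareKerTopMean` by the split
`λ = (λ − EQ″λ) + EQ″λ`, and the coarse Gram lower bound (L4′) `‖G_aQ″†c‖ ≥ |c|∕(‖Q″‖(‖D∘E‖² + a))` by the energy identity with test vector `Ec`.  HONEST: interpolant ∕ restoration
LETTERS of the curved γ-row supplier line; the `H²` row (`covLapSite ∘ E`) is NOT here (LOCATE-BUMP (W2)); ONE Thm 3.1-class Agmon brick (L3′) sits inside that line (Track A road cited);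
nothing of (3.49), Thm 3.3, `h349`, `hGF`, EX ∕ 19200 is proved here; rung R3, not d = 4, not a mass gap, not Clay.
[cite: Balaban1985BackgroundPropagators, (3.19) p.393, (3.114)–(3.115) p.418; Balaban1985Averaging, (97) p.32, pp.24–25; Balaban1985RegularSpaces, Lemma 1 (1.25) p.79; Balaban1985Variational, (2) p.278] -/
theorem exists_blockBump_rightInverse_of_regPr (hnK : n < K) {ε₀ : ℝ} (hε₀ : 0 < ε₀) (hε7 : 10 ^ 7 * (F.L : ℝ) ^ 3 * ε₀ ≤ 1)
    (U₀ : GaugeField (F.P K) 0 (Matrix.specialUnitaryGroup (Fin 2) ℂ)) (hreg : RegPr F n K ε₀ U₀) {c₀ : ℝ} [Fact (0 < c₀)]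
    (Q'' : SiteL2K ℂ 3 (periodsT3 F K) c₀ W₂ →ₗ[ℂ] (Site (F.P K) (K - n) → Matrix (Fin 2) (Fin 2) ℂ))
    (hseq : ∀ lam : Site (F.P K) 0 → Matrix (Fin 2) (Fin 2) ℂ, ∃ ns : (j : ℕ) → Site (F.P K) j → Matrix (Fin 2) (Fin 2) ℂ, ns 0 = lam ∧
        (∀ (j : ℕ) (y : Site (F.P K) (j + 1)), ns (j + 1) y = ns j (emb y) - meanCLM (Idx (F.P K)) (Matrix (Fin 2) (Fin 2) ℂ) fun i : Idx (F.P K) =>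
          ns j (emb y) - ((holT (emlIterU j (bgUnits F K U₀)) (emb y) (stairWord i.2.1 (off i.1)) : (Matrix (Fin 2) (Fin 2) ℂ)ˣ) : Matrix (Fin 2) (Fin 2) ℂ) *
            ns j (transl (emb y) (disp (stairWord i.2.1 (off i.1)))) * (((holT (emlIterU j (bgUnits F K U₀)) (emb y) (stairWord i.2.1 (off i.1)))⁻¹ : (Matrix (Fin 2) (Fin 2) ℂ)ˣ) : Matrix (Fin 2) (Fin 2) ℂ)) ∧
        ns (K - n) = Q'' (toL2S F K c₀ lam)) :
    ∃ E : (Site (F.P K) (K - n) → Matrix (Fin 2) (Fin 2) ℂ) →ₗ[ℂ] (Site (F.P K) 0 → Matrix (Fin 2) (Fin 2) ℂ),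
      (∀ c, Q'' (toL2S F K c₀ (E c)) = c) ∧
      (∀ c, ‖toL2S F K c₀ (E c)‖ ^ 2 ≤ 8 * (27 / 4 : ℝ) ^ 6 * (c₀ * ((F.L : ℝ) ^ 3) ^ (K - n) * ∑ y : Site (F.P K) (K - n), ‖c y‖ ^ 2)) ∧
      (∀ c, ‖DL2 F n K c₀ U₀ (toL2S F K c₀ (E c))‖ ^ 2 ≤ 600 * (27 / 4 : ℝ) ^ 6 * (c₀ * ((F.L : ℝ) ^ 3) ^ (K - n) * ∑ y : Site (F.P K) (K - n), ‖c y‖ ^ 2)) := by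
  have hc₀ : 0 < c₀ := Fact.out
  have hk : K - n ≤ (F.P K).m + (F.P K).K := Prop7CmapTwSReadSet.height_le F n K
  have hd3 : (F.P K).d = 3 := T3Family.P_d F K
  have hLL : ((F.P K).L : ℝ) = F.L := rfl
  have hL0 : (0 : ℝ) ≤ F.L := Nat.cast_nonneg _
  -- the dressed parabola bump as a linear map, and the Neumann step on `𝔐 := c ↦ Q''(toL2S(E_ref c))`
  obtain ⟨Eref, hEref⟩ := exists_linear_dressed F (n := n) U₀
  have hκhalf : 4500 * (F.L : ℝ) ^ 2 * ε₀ ≤ 1 / 2 := by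
    have h1 : (F.L : ℝ) ^ 2 * ε₀ ≤ (F.L : ℝ) ^ 3 * ε₀ := by
      have hL1 : (1:ℝ) ≤ F.L := by have := F.hL.2; exact_mod_cast (by omega : 1 ≤ F.L)
      have : (F.L : ℝ) ^ 2 ≤ (F.L : ℝ) ^ 3 := by nlinarith [pow_nonneg hL0 2]
      nlinarith [hε₀.le]
    nlinarith
  have hκ1 : 4500 * (F.L : ℝ) ^ 2 * ε₀ < 1 := by linarith
  have h𝔐 : ∀ c y, ‖(Q'' ∘ₗ (toL2S F K c₀).toLinearMap ∘ₗ Eref) c y - c y‖ ≤ (4500 * (F.L : ℝ) ^ 2 * ε₀) * ‖c y‖ := fun c y => by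
    have h := norm_topMean_dressed_sub_le F hnK hε₀ hε7 U₀ hreg Q'' hseq c y
    have he : Eref c = fun x => Eref c x := rfl
    rw [LinearMap.comp_apply, LinearMap.comp_apply, LinearEquiv.coe_toLinearMap, he]
    simp only [hEref]
    exact h
  obtain ⟨𝔑, h𝔐𝔑, -, h𝔑⟩ := exists_rightInverse_of_pointwise (𝕜 := ℂ) hκ1 h𝔐
  have h𝔑sq : ∀ c, ∑ y : Site (F.P K) (K - n), ‖𝔑 c y‖ ^ 2 ≤ 4 * ∑ y : Site (F.P K) (K - n), ‖c y‖ ^ 2 := fun c => by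
    rw [mul_sum]
    exact sum_le_sum fun y _ => by
      have h0 : 0 ≤ ‖𝔑 c y‖ := norm_nonneg _
      have h2 : ‖𝔑 c y‖ ≤ 2 * ‖c y‖ := by
        refine (h𝔑 c y).trans ?_
        rw [div_le_iff₀ (by linarith)]
        nlinarith [norm_nonneg (c y), hκhalf]
      calc ‖𝔑 c y‖ ^ 2 ≤ (2 * ‖c y‖) ^ 2 := pow_le_pow_left₀ h0 h2 2
        _ = 4 * ‖c y‖ ^ 2 := by ring
  -- the rows of `E_ref`
  have hpt : ∀ (c : Site (F.P K) (K - n) → Matrix (Fin 2) (Fin 2) ℂ) (x : Site (F.P K) 0), ‖Eref c x‖ ≤ (27 / 4 : ℝ) ^ (F.P K).d * ‖c (iterBlockOf (K - n) x)‖ :=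
    fun c x => by rw [hEref]; exact norm_dressed_le F hnK U₀ c x
  have hbond : ∀ (c : Site (F.P K) (K - n) → Matrix (Fin 2) (Fin 2) ℂ) (x : Site (F.P K) 0) (ν : Fin (F.P K).d),
      ‖conjR (bgUnits F K U₀ ⟨x, ν⟩) (Eref c (x.shift ν)) - Eref c x‖
        ≤ (2 * (27 / 4 : ℝ) ^ (F.P K).d * (2 * ((3 : ℝ) * ((F.L : ℝ) ^ (K - n) - 1)) * regThreshold F n K ε₀)
            + (27 / 4 : ℝ) ^ (F.P K).d * (4 / ((((F.P K).L ^ (K - n) : ℕ) : ℝ)))) * ‖c (iterBlockOf (K - n) x)‖ :=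
    fun c x ν => by rw [hEref, hEref]; exact norm_transport_dressed_bond_le F hnK hε₀ U₀ hreg.plaqSmall c x ν
  have hN : ((((F.P K).L ^ (F.P K).d) ^ (K - n) : ℕ) : ℝ) = ((F.L : ℝ) ^ 3) ^ (K - n) := by rw [hd3]; push_cast; rw [hLL]
  have hB := eta_inv_sq_mul_bondConst_sq_le F (n := n) (K := K) hε₀ hε7
  have hW0 : 0 ≤ c₀ * ((F.L : ℝ) ^ 3) ^ (K - n) := mul_nonneg hc₀.le (pow_nonneg (pow_nonneg hL0 3) (K - n))
  refine ⟨Eref ∘ₗ 𝔑, fun c => h𝔐𝔑 c, fun c => ?_, fun c => ?_⟩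
  · -- (ii) the `L²` row
    have h := normSq_toL2S_le_of_blockDominated F hk (c₀ := c₀) (Eref (𝔑 c)) (𝔑 c) (hpt (𝔑 c))
    rw [hN, hd3] at h
    have hS0 : 0 ≤ ∑ y : Site (F.P K) (K - n), ‖c y‖ ^ 2 := sum_nonneg fun y _ => sq_nonneg _
    calc ‖toL2S F K c₀ ((Eref ∘ₗ 𝔑) c)‖ ^ 2 = ‖toL2S F K c₀ (Eref (𝔑 c))‖ ^ 2 := rfl
      _ ≤ 2 * c₀ * (((27 / 4 : ℝ) ^ 3) ^ 2 * ((F.L : ℝ) ^ 3) ^ (K - n) * ∑ y : Site (F.P K) (K - n), ‖𝔑 c y‖ ^ 2) := h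
      _ = 2 * (27 / 4 : ℝ) ^ 6 * ((c₀ * ((F.L : ℝ) ^ 3) ^ (K - n)) * ∑ y : Site (F.P K) (K - n), ‖𝔑 c y‖ ^ 2) := by ring
      _ ≤ 2 * (27 / 4 : ℝ) ^ 6 * ((c₀ * ((F.L : ℝ) ^ 3) ^ (K - n)) * (4 * ∑ y : Site (F.P K) (K - n), ‖c y‖ ^ 2)) :=
          mul_le_mul_of_nonneg_left (mul_le_mul_of_nonneg_left (h𝔑sq c) hW0) (by positivity)
      _ = 8 * (27 / 4 : ℝ) ^ 6 * (c₀ * ((F.L : ℝ) ^ 3) ^ (K - n) * ∑ y : Site (F.P K) (K - n), ‖c y‖ ^ 2) := by ring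
  · -- (iii) the `H¹` row
    have h := normSq_DL2_le_of_blockDominated F (n := n) hk (c₀ := c₀) U₀ (Eref (𝔑 c)) (𝔑 c) (hbond (𝔑 c))
    rw [hN] at h
    have hd : ((F.P K).d : ℝ) = 3 := by rw [hd3]; norm_num
    rw [hd] at h
    have hS𝔑 : 0 ≤ ∑ y : Site (F.P K) (K - n), ‖𝔑 c y‖ ^ 2 := sum_nonneg fun y _ => sq_nonneg _
    set Bη : ℝ := (eta F n K)⁻¹ ^ 2 * ((2 * (27 / 4 : ℝ) ^ (F.P K).d * (2 * ((3 : ℝ) * ((F.L : ℝ) ^ (K - n) - 1)) * regThreshold F n K ε₀)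
        + (27 / 4 : ℝ) ^ (F.P K).d * (4 / ((((F.P K).L ^ (K - n) : ℕ) : ℝ)))) ^ 2) with hBη
    have hBη0 : 0 ≤ Bη := by rw [hBη]; positivity
    calc ‖DL2 F n K c₀ U₀ (toL2S F K c₀ ((Eref ∘ₗ 𝔑) c))‖ ^ 2 = ‖DL2 F n K c₀ U₀ (toL2S F K c₀ (Eref (𝔑 c)))‖ ^ 2 := rfl
      _ ≤ 2 * c₀ * ((eta F n K)⁻¹ ^ 2 * ((2 * (27 / 4 : ℝ) ^ (F.P K).d * (2 * ((3 : ℝ) * ((F.L : ℝ) ^ (K - n) - 1)) * regThreshold F n K ε₀)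
            + (27 / 4 : ℝ) ^ (F.P K).d * (4 / ((((F.P K).L ^ (K - n) : ℕ) : ℝ)))) ^ 2 * 3 * ((F.L : ℝ) ^ 3) ^ (K - n) * ∑ y : Site (F.P K) (K - n), ‖𝔑 c y‖ ^ 2)) := h
      _ = 6 * Bη * ((c₀ * ((F.L : ℝ) ^ 3) ^ (K - n)) * ∑ y : Site (F.P K) (K - n), ‖𝔑 c y‖ ^ 2) := by rw [hBη]; ring
      _ ≤ 6 * (25 * (27 / 4 : ℝ) ^ 6) * ((c₀ * ((F.L : ℝ) ^ 3) ^ (K - n)) * (4 * ∑ y : Site (F.P K) (K - n), ‖c y‖ ^ 2)) :=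
          mul_le_mul (mul_le_mul_of_nonneg_left hB (by norm_num)) (mul_le_mul_of_nonneg_left (h𝔑sq c) hW0) (mul_nonneg hW0 hS𝔑) (by positivity)
      _ = 600 * (27 / 4 : ℝ) ^ 6 * (c₀ * ((F.L : ℝ) ^ 3) ^ (K - n) * ∑ y : Site (F.P K) (K - n), ‖c y‖ ^ 2) := by ring

end Exact

/-! ## §5 (L4′) in the abstract: a right inverse with an `H¹` bound gives the coarse Gram lower bound by the energy identity -/

section Energy

open scoped InnerProductSpace

variable {H K C : Type*} [NormedAddCommGroup H] [InnerProductSpace ℂ H] [NormedAddCommGroup K] [InnerProductSpace ℂ K]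
  [NormedAddCommGroup C] [InnerProductSpace ℂ C]

/-- ★★ **(L4′) — THE COARSE GRAM LOWER BOUND FROM AN `H¹` RIGHT INVERSE, BY THE ENERGY IDENTITY** (★p1 g24 CHAIR WORD 22:01:23Z (2), adopted).  Abstractly: `D : H → K`, `Q : H → C`
linear, `a ≥ 0`, `‖Qv‖ ≤ q‖v‖`; `E : C → H` ANY right inverse of `Q` (`Q(Ec) = c`) with `‖D(Ec)‖ ≤ d_E‖c‖`; and `u` the weak solution of `(D†D + aQ†Q)u = Q†c`, i.e.
`⟪Du, Dv⟫ + a⟪Qu, Qv⟫ = ⟪c, Qv⟫` for all `v`.  Then **`‖c‖ ≤ q·(d_E² + a)·‖u‖`**, i.e. `⟨c, Q G_a² Q† c⟩ = ‖G_aQ†c‖² ≥ ‖c‖²∕(q(d_E² + a))²` for `G_a = (D†D + aQ†Q)⁻¹`: test with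
`v := Ec` (`‖c‖² = Re⟪Du, D(Ec)⟫ + a·Re⟪Qu, c⟫ ≤ (‖Du‖d_E + a‖Qu‖)‖c‖`), Cauchy–Schwarz in the energy `(‖Du‖d_E + a‖Qu‖)² ≤ (‖Du‖² + a‖Qu‖²)(d_E² + a)`, and `v := u`
(`‖Du‖² + a‖Qu‖² = Re⟪c, Qu⟫ ≤ q‖c‖‖u‖`).  No `H²` row of `E` is used (LOCATE-BUMP (i); supersedes the `H²`-test variant of ✓`Prop7ProjRangeBaCoarseGram` §2 at the member).
[cite: Balaban1985BackgroundPropagators, Thm 3.11 p.416 («(Q′G′²Q′*)⁻¹ … positive definite»), (3.21)–(3.26) pp.394–395] -/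
theorem norm_le_of_energy_rightInverse (D : H →ₗ[ℂ] K) (Q : H →ₗ[ℂ] C) {a q dE : ℝ} (ha : 0 ≤ a) (hdE : 0 ≤ dE)
    (hq : ∀ v, ‖Q v‖ ≤ q * ‖v‖) (E : C → H) (hQE : ∀ c, Q (E c) = c) (hDE : ∀ c, ‖D (E c)‖ ≤ dE * ‖c‖)
    (u : H) (c : C) (hweak : ∀ v, ⟪D u, D v⟫_ℂ + (a : ℂ) * ⟪Q u, Q v⟫_ℂ = ⟪c, Q v⟫_ℂ) :
    ‖c‖ ≤ q * (dE ^ 2 + a) * ‖u‖ := by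
  have hq0 : 0 ≤ q * ‖u‖ := by
    by_cases hu : u = 0
    · rw [hu, norm_zero, mul_zero]
    · have h := hq u
      have : 0 < ‖u‖ := norm_pos_iff.2 hu
      nlinarith [norm_nonneg (Q u)]
  -- the energy `S = ‖Du‖² + a‖Qu‖² = Re⟪c, Qu⟫ ≤ q‖c‖‖u‖`
  have hDD : (⟪D u, D u⟫_ℂ).re = ‖D u‖ ^ 2 := by rw [← RCLike.re_to_complex]; exact inner_self_eq_norm_sq (𝕜 := ℂ) (D u)
  have hQQ : (⟪Q u, Q u⟫_ℂ).re = ‖Q u‖ ^ 2 := by rw [← RCLike.re_to_complex]; exact inner_self_eq_norm_sq (𝕜 := ℂ) (Q u)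
  have hcc : (⟪c, c⟫_ℂ).re = ‖c‖ ^ 2 := by rw [← RCLike.re_to_complex]; exact inner_self_eq_norm_sq (𝕜 := ℂ) c
  have hS : ‖D u‖ ^ 2 + a * ‖Q u‖ ^ 2 ≤ ‖c‖ * (q * ‖u‖) := by
    have h := congrArg Complex.re (hweak u)
    rw [Complex.add_re, Complex.re_ofReal_mul, hDD, hQQ] at h
    rw [h]
    calc (⟪c, Q u⟫_ℂ).re ≤ ‖⟪c, Q u⟫_ℂ‖ := Complex.re_le_norm _
      _ ≤ ‖c‖ * ‖Q u‖ := norm_inner_le_norm _ _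
      _ ≤ ‖c‖ * (q * ‖u‖) := mul_le_mul_of_nonneg_left (hq u) (norm_nonneg _)
  -- the test vector `Ec`: `‖c‖² ≤ (‖Du‖·d_E + a‖Qu‖)·‖c‖`
  have hT : ‖c‖ ^ 2 ≤ (‖D u‖ * dE + a * ‖Q u‖) * ‖c‖ := by
    have h := congrArg Complex.re (hweak (E c))
    rw [hQE c, Complex.add_re, hcc] at h
    rw [← h]
    have e1 : (⟪D u, D (E c)⟫_ℂ).re ≤ ‖D u‖ * dE * ‖c‖ :=
      (Complex.re_le_norm _).trans ((norm_inner_le_norm _ _).trans (by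
        have := hDE c; have := norm_nonneg (D u); nlinarith))
    have e2 : ((a : ℂ) * ⟪Q u, c⟫_ℂ).re ≤ a * ‖Q u‖ * ‖c‖ := by
      rw [Complex.re_ofReal_mul, mul_assoc]
      exact mul_le_mul_of_nonneg_left ((Complex.re_le_norm _).trans (norm_inner_le_norm _ _)) ha
    nlinarith [e1, e2]
  -- Cauchy–Schwarz in the energy and conclusion
  by_cases hc : c = 0
  · rw [hc, norm_zero]
    calc (0:ℝ) ≤ q * ‖u‖ * (dE ^ 2 + a) := mul_nonneg hq0 (by positivity)
      _ = q * (dE ^ 2 + a) * ‖u‖ := by ring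
  · have hcpos : 0 < ‖c‖ := norm_pos_iff.2 hc
    have hT' : ‖c‖ ≤ ‖D u‖ * dE + a * ‖Q u‖ := le_of_mul_le_mul_right (by nlinarith [hT]) hcpos
    have hCS : (‖D u‖ * dE + a * ‖Q u‖) ^ 2 ≤ (‖D u‖ ^ 2 + a * ‖Q u‖ ^ 2) * (dE ^ 2 + a) := by
      nlinarith [mul_nonneg ha (sq_nonneg (‖D u‖ - ‖Q u‖ * dE)), sq_nonneg dE, norm_nonneg (D u), norm_nonneg (Q u)]
    have h1 : ‖c‖ ^ 2 ≤ (‖D u‖ ^ 2 + a * ‖Q u‖ ^ 2) * (dE ^ 2 + a) := by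
      have h0 : 0 ≤ ‖D u‖ * dE + a * ‖Q u‖ := by have := norm_nonneg (D u); have := norm_nonneg (Q u); positivity
      calc ‖c‖ ^ 2 ≤ (‖D u‖ * dE + a * ‖Q u‖) ^ 2 := pow_le_pow_left₀ hcpos.le hT' 2
        _ ≤ _ := hCS
    have h2 : ‖c‖ ^ 2 ≤ ‖c‖ * (q * ‖u‖) * (dE ^ 2 + a) := h1.trans (mul_le_mul_of_nonneg_right hS (by positivity))
    have h3 : ‖c‖ ≤ q * ‖u‖ * (dE ^ 2 + a) := le_of_mul_le_mul_right (by nlinarith [h2]) hcpos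
    linarith [h3]

end Energy

end Summit.QuantumFields.YangMills.Theorems.Prop7CovariantBlockBumps

end
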